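import Summits.Ventures.PercRepro.RankLevelSetPerElemChain
import Summits.Ventures.PercRepro.RankLevelSetPerElemThreeSkel

/-! # RankLevelSetPerElemCircuit — THE PER-CIRCUIT INEQUALITY OF (★★) AT EVERY LEVEL, BY THE UP-SHADOW CHAIN IN
THE DUAL (night-1 g36; dossier §48.12; on `RankLevelSetPerElemChain` and `RankLevelSetPerElemThreeSkel`)

For `y ∈ E` in no parallel pair on a coloop-free matroid, an absorbing `j`-set `Z₀` with circuit `K = C_y(Z₀)`,
`S := K ∖ {y}` (`s := #S`), `H := E ∖ K` (`h := #H = #E − s − 1`) and the dual `N := M✶`: the MEMBERS of `K` at level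
`j` — the absorbing `j`-sets with circuit `K` — are the sets `S ∪ X` for `X` in the hyperplane family
`{X ⊆ H : #X = j − s, S ∪ X spans N, insert y (H ∖ X) spans N}` (`members_subset_image`), and the TARGETS of `K` at
level `j + 1` — the bi-independent `(j+1)`-sets `Q` through `y` whose complement spans `y` with circuit `K` —
contain the sets `insert y (H ∖ X)` for `X` in the same family at level `h − j` (`image_subset_targets`). The
dual facts (`absorb_dual_facts`, `circuit_dual_facts`): `H` is a hyperplane of `N` avoiding `y` (`E ∖ S =
insert y H` spans since `S` is independent, `H = E ∖ K` does not since `K` is dependent), of rank `≤ j − 1`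
(`Z₀` spans `N`), of nonloops. The up-shadow chain `le_of_chain` / `absorbFam_step` from level `j − s` to level
`h − j` closes as soon as `#K + 1 ≥ j` (**`perCircuit_le`**): for `j ≤ 4` every circuit qualifies. Every
declaration has a docstring; imports: the cell's own modules and Mathlib only. Axioms: standard. -/

namespace PercRepro

open Set Matroid

variable {α : Type} (M : Matroid α) [M.Finite]

/-! ## The dual facts of an absorbing set, at every level -/

/-- For an absorbing `k`-set `Z` avoiding `y` and `J := E ∖ insert y Z`: `insert y J = E ∖ Z` spans `M✶`, `J` does
not, `y ∉ cl✶ J`, `Z` spans `M✶`, and `M✶` has rank at most `k`. -/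
lemma absorb_dual_facts {y : α} (hy : y ∈ M.E) {k : ℕ} {Z : Set α} (hZ : Z ∈ lowAbsorbAt M y k) :
    M.E \ Z = insert y (M.E \ insert y Z) ∧ M✶.Spanning (insert y (M.E \ insert y Z)) ∧
      ¬ M✶.Spanning (M.E \ insert y Z) ∧ y ∉ M✶.closure (M.E \ insert y Z) ∧ M✶.Spanning Z ∧
      M✶.eRank ≤ k := by
  obtain ⟨⟨hZE, hZk, hZi, hcind⟩, hyZ, hdep⟩ := hZ
  have hyZE : insert y Z ⊆ M.E := Set.insert_subset hy hZE
  have hZfin : Z.Finite := M.ground_finite.subset hZE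
  have hIeq : M.E \ Z = insert y (M.E \ insert y Z) := by
    ext x
    simp only [Set.mem_sdiff, Set.mem_insert_iff, not_or]
    constructor
    · rintro ⟨hxE, hxZ⟩
      by_cases hxy : x = y
      · exact Or.inl hxy
      · exact Or.inr ⟨hxE, hxy, hxZ⟩
    · rintro (rfl | ⟨hxE, -, hxZ⟩)
      · exact ⟨hy, hyZ⟩
      · exact ⟨hxE, hxZ⟩
  have hIs : M✶.Spanning (insert y (M.E \ insert y Z)) := by
    rw [← hIeq]; exact (indep_iff_dual_spanning_compl M hZE).mp hZi
  have hZs : M✶.Spanning Z := (indep_compl_iff_dual_spanning M hZE).mp hcind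
  have hJns : ¬ M✶.Spanning (M.E \ insert y Z) :=
    fun h => hdep ((indep_iff_dual_spanning_compl M hyZE).mpr h)
  have hrank : M✶.eRank ≤ k := by
    have h1 := (Matroid.spanning_iff_eRk_le (by rwa [Matroid.dual_ground])).mp hZs
    have h2 : M✶.eRk Z ≤ k := by
      calc M✶.eRk Z ≤ Z.encard := M✶.eRk_le_encard Z
        _ = k := by rw [← hZfin.cast_ncard_eq, hZk]
    exact h1.trans h2
  exact ⟨hIeq, hIs, hJns, notMem_closure_of_spanning_insert hIs hJns, hZs, hrank⟩

/-! ## The circuit, its hyperplane, and the two halves -/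

/-- **The dual facts of the circuit `K` of an absorbing `j`-set `Z₀`** (coloop-free `M`, `y` in no parallel pair):
with `S := K ∖ {y}` and `H := E ∖ K`: `K = insert y S`, `S ⊆ Z₀`, `S` and `H` are disjoint subsets of `E`,
`E ∖ S = insert y H`, `insert y H` spans `M✶`, `y ∉ cl✶ H`, every element of `H` is a nonloop of `M✶`, and
`rk✶ H + 1 ≤ j`. -/
lemma circuit_dual_facts (hcol : ∀ e, ¬ M.IsColoop e) {y : α} (hy : y ∈ M.E) {j : ℕ} {Z₀ : Set α}
    (hZ₀ : Z₀ ∈ lowAbsorbAt M y j) :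
    M.fundCircuit y Z₀ = insert y (M.fundCircuit y Z₀ \ {y}) ∧ M.fundCircuit y Z₀ \ {y} ⊆ Z₀ ∧
      M.fundCircuit y Z₀ \ {y} ⊆ M.E ∧ M.E \ M.fundCircuit y Z₀ ⊆ M.E ∧
      Disjoint (M.fundCircuit y Z₀ \ {y}) (M.E \ M.fundCircuit y Z₀) ∧
      M.E \ (M.fundCircuit y Z₀ \ {y}) = insert y (M.E \ M.fundCircuit y Z₀) ∧
      M✶.Spanning (insert y (M.E \ M.fundCircuit y Z₀)) ∧ y ∉ M✶.closure (M.E \ M.fundCircuit y Z₀) ∧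
      (∀ e ∈ M.E \ M.fundCircuit y Z₀, M✶.IsNonloop e) ∧ M✶.eRk (M.E \ M.fundCircuit y Z₀) + 1 ≤ j := by
  obtain ⟨-, -, -, -, -, hrank⟩ := absorb_dual_facts M hy hZ₀
  have hycl := mem_closure_of_mem_lowAbsorbAt' M hy hZ₀
  obtain ⟨⟨hZE, -, hZi, -⟩, hyZ, -⟩ := hZ₀
  set K := M.fundCircuit y Z₀ with hK
  have hKcirc : M.IsCircuit K := hZi.fundCircuit_isCircuit hycl hyZ
  have hyK : y ∈ K := M.mem_fundCircuit y Z₀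
  have hKsub : K ⊆ insert y Z₀ := M.fundCircuit_subset_insert y Z₀
  have hKE : K ⊆ M.E := hKsub.trans (Set.insert_subset hy hZE)
  have hKeq : K = insert y (K \ {y}) := by rw [Set.insert_sdiff_singleton, Set.insert_eq_of_mem hyK]
  have hSZ : K \ {y} ⊆ Z₀ := by
    rintro x ⟨hxK, hxy⟩
    rcases hKsub hxK with h | h
    · exact absurd h hxy
    · exact h
  have hSE : K \ {y} ⊆ M.E := Set.sdiff_subset.trans hKE
  have hHE : M.E \ K ⊆ M.E := Set.sdiff_subset
  have hdisj : Disjoint (K \ {y}) (M.E \ K) := Set.disjoint_left.mpr (fun x hxS hxH => hxH.2 hxS.1)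
  have hE1 : M.E \ (K \ {y}) = insert y (M.E \ K) := by
    ext x
    simp only [Set.mem_sdiff, Set.mem_insert_iff, Set.mem_singleton_iff, not_and, not_not]
    constructor
    · rintro ⟨hxE, hx⟩
      by_cases hxy : x = y
      · exact Or.inl hxy
      · exact Or.inr ⟨hxE, fun hxK => hxy (hx hxK)⟩
    · rintro (rfl | ⟨hxE, hxK⟩)
      · exact ⟨hy, fun _ => rfl⟩
      · exact ⟨hxE, fun h => absurd h hxK⟩
  have hSi : M.Indep (K \ {y}) := hZi.subset hSZ
  have hHy : M✶.Spanning (insert y (M.E \ K)) := by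
    rw [← hE1]; exact (indep_iff_dual_spanning_compl M hSE).mp hSi
  have hHns : ¬ M✶.Spanning (M.E \ K) :=
    fun h => hKcirc.dep.not_indep ((indep_iff_dual_spanning_compl M hKE).mpr h)
  have hyH : y ∉ M✶.closure (M.E \ K) := notMem_closure_of_spanning_insert hHy hHns
  have hnl : ∀ e ∈ M.E \ K, M✶.IsNonloop e := by
    intro e he
    refine Matroid.isNonloop_of_not_isLoop (by rw [Matroid.dual_ground]; exact he.1) ?_
    rw [Matroid.dual_isLoop_iff_isColoop]
    exact hcol e
  have hrk : M✶.eRk (M.E \ K) + 1 ≤ j := by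
    rw [eRk_add_one_eq_eRank_of_spanning_insert (by rwa [Matroid.dual_ground]) hyH hHy]
    exact hrank
  exact ⟨hKeq, hSZ, hSE, hHE, hdisj, hE1, hHy, hyH, hnl, hrk⟩

/-- **The members of a circuit inject into the hyperplane family at level `j − s`** by `Z ↦ Z ∖ S`. -/
lemma members_le_fam {y : α} (hy : y ∈ M.E) {j : ℕ} {Z₀ : Set α} (hZ₀ : Z₀ ∈ lowAbsorbAt M y j) :
    {Z ∈ lowAbsorbAt M y j | M.fundCircuit y Z = M.fundCircuit y Z₀}.ncard ≤
      {X | X ⊆ M.E \ M.fundCircuit y Z₀ ∧ X.ncard = j - (M.fundCircuit y Z₀ \ {y}).ncard ∧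
        M✶.Spanning ((M.fundCircuit y Z₀ \ {y}) ∪ X) ∧
        M✶.Spanning (insert y ((M.E \ M.fundCircuit y Z₀) \ X))}.ncard := by
  set K := M.fundCircuit y Z₀ with hK
  set S := K \ {y} with hS
  set H := M.E \ K with hH
  have hHE : H ⊆ M.E := Set.sdiff_subset
  have hyK : y ∈ K := M.mem_fundCircuit y Z₀
  have hfin : {X | X ⊆ H ∧ X.ncard = j - S.ncard ∧ M✶.Spanning (S ∪ X) ∧ M✶.Spanning (insert y (H \ X))}.Finite :=
    (M.ground_finite.subset hHE).finite_subsets.subset (fun _ hX => hX.1)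
  -- every member contains `S`
  have hSZ : ∀ Z ∈ {Z ∈ lowAbsorbAt M y j | M.fundCircuit y Z = K}, S ⊆ Z := by
    rintro Z ⟨-, hfZ⟩ x ⟨hxK, hxy⟩
    have hxK' : x ∈ M.fundCircuit y Z := by rw [hfZ]; exact hxK
    rcases M.fundCircuit_subset_insert y Z hxK' with h | h
    · exact absurd h hxy
    · exact h
  refine Set.ncard_le_ncard_of_injOn (fun Z => Z \ S) ?_ ?_ hfin
  · intro Z hZmem
    have hSZ' := hSZ Z hZmem
    obtain ⟨⟨⟨hZE, hZj, hZi, hcind⟩, hyZ, -⟩, hfZ⟩ := hZmem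
    have hZfin : Z.Finite := M.ground_finite.subset hZE
    -- `E ∖ Z = insert y (H ∖ (Z ∖ S))`
    have heq : insert y (H \ (Z \ S)) = M.E \ Z := by
      ext x
      constructor
      · rintro (rfl | ⟨⟨hxE, hxK⟩, hxZS⟩)
        · exact ⟨hy, hyZ⟩
        · refine ⟨hxE, fun hxZ => hxZS ⟨hxZ, fun hxS => hxK hxS.1⟩⟩
      · rintro ⟨hxE, hxZ⟩
        by_cases hxy : x = y
        · exact Or.inl hxy
        · refine Or.inr ⟨⟨hxE, fun hxK => hxZ (hSZ' ⟨hxK, hxy⟩)⟩, fun h => hxZ h.1⟩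
    refine ⟨?_, ?_, ?_, ?_⟩
    · rintro x ⟨hxZ, hxS⟩
      exact ⟨hZE hxZ, fun hxK => hxS ⟨hxK, fun h => hyZ (by rw [Set.mem_singleton_iff] at h; rw [← h]; exact hxZ)⟩⟩
    · rw [Set.ncard_sdiff hSZ' (hZfin.subset hSZ'), hZj]
    · rw [Set.union_sdiff_cancel hSZ']
      exact (indep_compl_iff_dual_spanning M hZE).mp hcind
    · rw [heq]
      exact (indep_iff_dual_spanning_compl M hZE).mp hZi
  · intro Z₁ hZ₁ Z₂ hZ₂ heq
    have h1 := hSZ Z₁ hZ₁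
    have h2 := hSZ Z₂ hZ₂
    have heq' : Z₁ \ S = Z₂ \ S := heq
    rw [← Set.union_sdiff_cancel h1, ← Set.union_sdiff_cancel h2, heq']

/-- **The hyperplane family at level `h − j` injects into the targets of the circuit** by
`X ↦ insert y (H ∖ X)` (`j + 1 ≤ #E` for the size; the circuit `K` is recovered as the circuit of `y` in
`E ∖ Q = S ∪ X`). -/
lemma fam_le_targets {y : α} (hy : y ∈ M.E) {j : ℕ} (hn : 2 * j + 1 ≤ M.E.ncard) {Z₀ : Set α}
    (hZ₀ : Z₀ ∈ lowAbsorbAt M y j) :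
    {X | X ⊆ M.E \ M.fundCircuit y Z₀ ∧ X.ncard = (M.E \ M.fundCircuit y Z₀).ncard - j ∧
        M✶.Spanning ((M.fundCircuit y Z₀ \ {y}) ∪ X) ∧
        M✶.Spanning (insert y ((M.E \ M.fundCircuit y Z₀) \ X))}.ncard ≤
      {Q ∈ biIndep M (j + 1) | y ∈ Q ∧ ¬ M.Indep (insert y (M.E \ Q)) ∧
        M.fundCircuit y (M.E \ Q) = M.fundCircuit y Z₀}.ncard := by
  have hycl := mem_closure_of_mem_lowAbsorbAt' M hy hZ₀
  obtain ⟨⟨hZE, hZj, hZi, -⟩, hyZ, -⟩ := hZ₀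
  set K := M.fundCircuit y Z₀ with hK
  set S := K \ {y} with hS
  set H := M.E \ K with hH
  have hKcirc : M.IsCircuit K := hZi.fundCircuit_isCircuit hycl hyZ
  have hyK : y ∈ K := M.mem_fundCircuit y Z₀
  have hKsub : K ⊆ insert y Z₀ := M.fundCircuit_subset_insert y Z₀
  have hKE : K ⊆ M.E := hKsub.trans (Set.insert_subset hy hZE)
  have hKeq : K = insert y S := by rw [hS, Set.insert_sdiff_singleton, Set.insert_eq_of_mem hyK]
  have hSE : S ⊆ M.E := Set.sdiff_subset.trans hKE
  have hHE : H ⊆ M.E := Set.sdiff_subset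
  have hHfin : H.Finite := M.ground_finite.subset hHE
  have hyH : y ∉ H := fun h => h.2 hyK
  have hjH : j ≤ H.ncard := by
    -- `H ⊇ E ∖ (Z₀ ∪ {y})`... simpler: `#K ≤ j + 1`, `#H = #E − #K`, and `#E ≥ 2j + 1`? use `E ∖ Z₀ ⊆ insert y H`
    have hsub : M.E \ Z₀ ⊆ insert y H := by
      rintro x ⟨hxE, hxZ⟩
      by_cases hxy : x = y
      · exact Or.inl hxy
      · exact Or.inr ⟨hxE, fun hxK => hxZ (by
          rcases hKsub hxK with h | h
          · exact absurd h hxy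
          · exact h)⟩
    have h1 := Set.ncard_le_ncard hsub (hHfin.insert y)
    rw [Set.ncard_sdiff hZE (M.ground_finite.subset hZE), hZj, Set.ncard_insert_of_notMem hyH hHfin] at h1
    omega
  have hfin : {Q ∈ biIndep M (j + 1) | y ∈ Q ∧ ¬ M.Indep (insert y (M.E \ Q)) ∧ M.fundCircuit y (M.E \ Q) = K}.Finite :=
    (biIndep_finite M (j + 1)).subset (fun Q hQ => hQ.1)
  refine Set.ncard_le_ncard_of_injOn (fun X => insert y (H \ X)) ?_ ?_ hfin
  · rintro X ⟨hXH, hXc, hXs, hXy⟩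
    have hXfin : X.Finite := hHfin.subset hXH
    have hyX : y ∉ X := fun h => hyH (hXH h)
    have hyHX : y ∉ H \ X := fun h => hyH h.1
    -- `E ∖ insert y (H ∖ X) = S ∪ X`
    have hcompl : M.E \ insert y (H \ X) = S ∪ X := by
      ext x
      constructor
      · rintro ⟨hxE, hx⟩
        simp only [Set.mem_insert_iff, Set.mem_sdiff, not_or, not_and, not_not] at hx
        by_cases hxK : x ∈ K
        · exact Or.inl ⟨hxK, by simpa using hx.1⟩
        · exact Or.inr (hx.2 ⟨hxE, hxK⟩)
      · rintro (hxS | hxX)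
        · refine ⟨hSE hxS, ?_⟩
          simp only [Set.mem_insert_iff, Set.mem_sdiff, not_or, not_and, not_not]
          exact ⟨fun h => hxS.2 (by rw [Set.mem_singleton_iff]; exact h), fun hxH => absurd hxS.1 hxH.2⟩
        · refine ⟨hHE (hXH hxX), ?_⟩
          simp only [Set.mem_insert_iff, Set.mem_sdiff, not_or, not_and, not_not]
          exact ⟨fun h => hyX (h ▸ hxX), fun _ => hxX⟩
    have hQE : insert y (H \ X) ⊆ M.E := Set.insert_subset hy (Set.sdiff_subset.trans hHE)
    have hSXi : M.Indep (S ∪ X) := by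
      rw [indep_iff_dual_spanning_compl M (Set.union_subset hSE (hXH.trans hHE))]
      have : M.E \ (S ∪ X) = insert y (H \ X) := by
        rw [← hcompl, Set.sdiff_sdiff_cancel_left hQE]
      rw [this]; exact hXy
    refine ⟨⟨hQE, ?_, ?_, ?_⟩, Set.mem_insert y _, ?_, ?_⟩
    · rw [Set.ncard_insert_of_notMem hyHX (hHfin.subset Set.sdiff_subset), Set.ncard_sdiff hXH hXfin, hXc]
      omega
    · rw [indep_iff_dual_spanning_compl M hQE, hcompl]; exact hXs
    · rw [hcompl]; exact hSXi
    · rw [hcompl]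
      intro hind
      exact hKcirc.dep.not_indep (hind.subset (by rw [hKeq]; exact Set.insert_subset_insert Set.subset_union_left))
    · rw [hcompl]
      exact (hKcirc.eq_fundCircuit_of_subset hSXi (by rw [hKeq]; exact Set.insert_subset_insert Set.subset_union_left)).symm
  · rintro X₁ ⟨hX₁, -, -, -⟩ X₂ ⟨hX₂, -, -, -⟩ heq
    have heq' : insert y (H \ X₁) = insert y (H \ X₂) := heq
    have hy1 : y ∉ H \ X₁ := fun h => hyH h.1
    have hy2 : y ∉ H \ X₂ := fun h => hyH h.1
    have h3 : H \ X₁ = H \ X₂ := by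
      have := congrArg (fun T => T \ {y}) heq'
      simpa [Set.insert_sdiff_of_mem _ (Set.mem_singleton y), Set.sdiff_singleton_eq_self hy1,
        Set.sdiff_singleton_eq_self hy2] using this
    rw [← Set.sdiff_sdiff_cancel_left hX₁, ← Set.sdiff_sdiff_cancel_left hX₂, h3]


/-! ## The per-circuit inequality -/

/-- **THE PER-CIRCUIT INEQUALITY OF (★★) AT LEVEL `j`** (coloop-free `M`, `y ∈ E`, `2 ≤ j`, `2j + 1 < #E`): for an
absorbing `j`-set `Z₀` whose circuit `K = C_y(Z₀)` has `#K + 1 ≥ j` elements, the members of `K` at level `j` are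
at most the targets of `K` at level `j + 1` — the up-shadow chain of the hyperplane family from level `j − s` to
level `h − j` (`s = #K − 1`, `h = #E − #K`), whose telescoped product is favourable exactly when `j ≤ s + 2`. -/
theorem perCircuit_le (hcol : ∀ e, ¬ M.IsColoop e) {y : α} (hy : y ∈ M.E) {j : ℕ} (hj : 2 ≤ j)
    (hn : 2 * j + 1 < M.E.ncard) {Z₀ : Set α} (hZ₀ : Z₀ ∈ lowAbsorbAt M y j)
    (hK : j ≤ (M.fundCircuit y Z₀).ncard + 1) :
    {Z ∈ lowAbsorbAt M y j | M.fundCircuit y Z = M.fundCircuit y Z₀}.ncard ≤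
      {Q ∈ biIndep M (j + 1) | y ∈ Q ∧ ¬ M.Indep (insert y (M.E \ Q)) ∧
        M.fundCircuit y (M.E \ Q) = M.fundCircuit y Z₀}.ncard := by
  obtain ⟨hKeq, hSZ, hSE, hHE, -, -, hHy, hyH, hnl, hrk⟩ := circuit_dual_facts M hcol hy hZ₀
  have h1 := members_le_fam M hy hZ₀
  have h2 := fam_le_targets M hy (by omega) hZ₀
  have hZE : Z₀ ⊆ M.E := hZ₀.1.1
  have hZj : Z₀.ncard = j := hZ₀.1.2.1
  set K := M.fundCircuit y Z₀ with hK'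
  set S := K \ {y} with hS
  set H := M.E \ K with hH
  have hyK : y ∈ K := M.mem_fundCircuit y Z₀
  have hKE : K ⊆ M.E := hKeq ▸ Set.insert_subset hy hSE
  have hKfin : K.Finite := M.ground_finite.subset hKE
  have hKcard : K.ncard = S.ncard + 1 := by
    rw [hS, Set.ncard_sdiff_singleton_of_mem hyK]
    have : 1 ≤ K.ncard := (Set.ncard_pos hKfin).mpr ⟨y, hyK⟩
    omega
  have hKle : K.ncard ≤ M.E.ncard := Set.ncard_le_ncard hKE M.ground_finite
  have hHcard : H.ncard + K.ncard = M.E.ncard := by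
    rw [hH, Set.ncard_sdiff hKE hKfin]; omega
  have hsj : S.ncard ≤ j := by
    rw [← hZj]; exact Set.ncard_le_ncard hSZ (M.ground_finite.subset hZE)
  have hyE' : y ∈ M✶.E := by rwa [Matroid.dual_ground]
  have hHE' : H ⊆ M✶.E := by rwa [Matroid.dual_ground]
  have hSE' : S ⊆ M✶.E := by rwa [Matroid.dual_ground]
  -- the rank of `H` in the dual is at most `j − 1`
  have hρ : M✶.eRk H ≤ ((j - 1 : ℕ) : ℕ∞) := by
    have h : M✶.eRk H + 1 ≤ ((j - 1 : ℕ) : ℕ∞) + 1 := by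
      rw [show ((j - 1 : ℕ) : ℕ∞) + 1 = ((j : ℕ) : ℕ∞) by norm_cast; omega]
      exact hrk
    exact (WithTop.add_le_add_iff_right (by decide)).mp h
  -- the chain from level `j − s` to level `h − j`
  set f : ℕ → ℕ := fun i =>
    {X | X ⊆ H ∧ X.ncard = i ∧ M✶.Spanning (S ∪ X) ∧ M✶.Spanning (insert y (H \ X))}.ncard with hf
  have hchain : f (j - S.ncard) ≤ f (H.ncard - j) := by
    have hm : H.ncard - j = (j - S.ncard) + ((H.ncard + S.ncard) - 2 * j) := by omega
    rw [hm]
    refine le_of_chain f (c := H.ncard - j + 2 - (j - S.ncard)) (by omega) ?_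
    intro t ht
    have hstep := absorbFam_step (S := S) hHE' hSE' hyE' hyH hHy hnl hρ (by omega)
      (i := j - S.ncard + t) (by omega)
    have e1 : H.ncard - (j - S.ncard + t) - (j - 1 - 1) = H.ncard - j + 2 - (j - S.ncard) - t := by omega
    rw [e1] at hstep
    exact hstep
  calc {Z ∈ lowAbsorbAt M y j | M.fundCircuit y Z = M.fundCircuit y Z₀}.ncard ≤ f (j - S.ncard) := h1
    _ ≤ f (H.ncard - j) := hchain
    _ ≤ _ := h2

end PercRepro
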